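import Summits.AtomisticToContinuum.Crystallization.Theorems.FrustratedLawDichotomyCellSymmZ3

/-!
# FrustratedLawDichotomy · crux `AperiodicFrustratedLawGap` (stmt-AtomisticToContinuum-27623) — class-A K-file skeleton, layer 0:
the label symmetry group `Stab16` of a UNIAXIAL template (decomp-a2c hand-2 g47, structural share; KFILE-FORMAT ed2+A+B §3′, «most
general landed lemma first, then specialise»)

Every Tier-K cell of the atlas is a `(100)`-uniaxial linear template `a m = T·z m`, `T = diag(t₀, t₁, t₁)` (F1 and the whole RELABEL54
band family; critic r1792 §8′: «the (100)-uniaxial F1 family first (|Stab| = 16 each)»).  Its label stabiliser in the signed-permutation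
group of `Fin 3` is the 16-element group `D₄ₕ` = (identity or the swap `1 ↔ 2`) × (three independent signs).  This file fixes, ONCE for all
such cells, the tables TOY ROW 6/7/8 carried inline: the permutation part `pK k`, the sign part `sK k`, the integer matrix `RZ k = spMatZ
(pK k) (sK k)` and its real cast `Rr k`, the two decided group facts `pK_inj` / `sK_pm`, and the one-line consequences a `Labels` file
hands to (XV) `nn_of_reps` / `hf_of_reps` / `fc_of_reps`: `act_inj` (hP), `image_eq` (hM/hMI from a closure), `ballL_eq` (hnb/hnbh),
`nearId_mul` (hB), plus the integer invariances used to prove closures BY PREDICATE (parity, cube, quadratic form with `RᵀAR = A`)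
and the canonical orbit representative `rep16 m = (|m₀|, max |m₁| |m₂|, min |m₁| |m₂|)` with the transporting element `symOf16`
(found by search; its per-label correctness is a decided list fact in each cell, as TOY ROW 8's `hcov0`).
-/

namespace Summit.AtomisticToContinuum.Crystallization.Theorems.FrustratedLawDichotomyCellStab16

open scoped BigOperators
open Summit.AtomisticToContinuum.Crystallization.Theorems.FrustratedLawDichotomyCellClasses (ballL)
open Summit.AtomisticToContinuum.Crystallization.Theorems.FrustratedLawDichotomyCellTriples (zT sumT)
open Summit.AtomisticToContinuum.Crystallization.Theorems.FrustratedLawDichotomyCellSymm (spMatZ spMatZ_map)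
open Summit.AtomisticToContinuum.Crystallization.Theorems.FrustratedLawDichotomyCellSymmZ3
  (actZ actZ_injective even_sumT_actZ_iff abs_zT_actZ_le image_actZ_eq ballL_actZ nearId_mul_spMatZ qZ qZ_actZ sumSq_zT_actZ sumSq_zT_actZ')

/-! ## §1 The sixteen elements -/

/-- permutation part of element `k`: the identity for `k < 8`, the swap `1 ↔ 2` for `k ≥ 8` (axis `0` is always fixed). -/
def pK (k : Fin 16) : Fin 3 → Fin 3 := fun i => if k.val < 8 then i else if i = 0 then 0 else if i = 1 then 2 else 1

/-- sign part of element `k`: bit `i` of `k` flips axis `i`. -/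
def sK (k : Fin 16) : Fin 3 → ℤ := fun i => if k.val / 2 ^ i.val % 2 = 1 then -1 else 1

/-- the integer matrix of element `k`. -/
def RZ (k : Fin 16) : Matrix (Fin 3) (Fin 3) ℤ := spMatZ (pK k) (sK k)

/-- its real cast (the matrix `R` with `a (act m) = R · a m` and `F ↦ F·R` on the strain cell). -/
noncomputable def Rr (k : Fin 16) : Matrix (Fin 3) (Fin 3) ℝ := (RZ k).map fun t : ℤ => (t : ℝ)

/-- the permutation parts are injective (decided). -/
theorem pK_inj : ∀ k : Fin 16, Function.Injective (pK k) := by decide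

/-- the sign parts are `±1` (decided). -/
theorem sK_pm : ∀ k : Fin 16, ∀ j, sK k j = 1 ∨ sK k j = -1 := by decide

/-- element `0` is the identity matrix. -/
theorem RZ_zero : RZ 0 = 1 := by decide

/-- `Rr k` is the real cast of the signed permutation matrix (the shape (XV) `nearId_mul_spMat` speaks about). -/
theorem Rr_eq (k : Fin 16) : Rr k = (spMatZ (pK k) (sK k)).map fun t : ℤ => (t : ℝ) := rfl

/-! ## §2 The hypotheses of (XV) `nn_of_reps` / `hf_of_reps` / `fc_of_reps`, one line each -/

/-- (hP) the label action of every element is injective. -/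
theorem act_inj (k : Fin 16) : Function.Injective (actZ (RZ k)) := actZ_injective (pK_inj k) (sK_pm k)

/-- (hM / hMI) a label set closed under element `k` is mapped onto itself — closure is proved BY PREDICATE in each cell, never by list comparison. -/
theorem image_eq (k : Fin 16) {M : Finset (ℤ × ℤ × ℤ)} (hclos : ∀ x ∈ M, actZ (RZ k) x ∈ M) : M.image (actZ (RZ k)) = M :=
  image_actZ_eq (pK_inj k) (sK_pm k) hclos

/-- (hnb / hnbh) integer near lists are carried along. -/
theorem ballL_eq (k : Fin 16) {M : Finset (ℤ × ℤ × ℤ)} (hM : M.image (actZ (RZ k)) = M) (ℓ : ℤ) :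
    ∀ m ∈ M, ballL M zT ℓ (actZ (RZ k) m) = (ballL M zT ℓ m).image (actZ (RZ k)) :=
  ballL_actZ (pK_inj k) (sK_pm k) hM ℓ

/-- (hB) the strain cell `|FᵀF − 1| ≤ ε` is mapped to itself by `F ↦ F · Rr k`. -/
theorem nearId_mul (k : Fin 16) {F : Matrix (Fin 3) (Fin 3) ℝ} {ε : ℝ}
    (hG : ∀ i j, |(F.transpose * F) i j - (if i = j then 1 else 0)| ≤ ε) :
    ∀ i j, |((F * Rr k).transpose * (F * Rr k)) i j - (if i = j then 1 else 0)| ≤ ε :=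
  nearId_mul_spMatZ (pK_inj k) (sK_pm k) hG

/-! ## §3 The integer invariances behind closure-by-predicate -/

/-- parity of a label is invariant. -/
theorem even_sumT_act_iff (k : Fin 16) (m : ℤ × ℤ × ℤ) : Even (sumT (actZ (RZ k) m)) ↔ Even (sumT m) :=
  even_sumT_actZ_iff (pK_inj k) (sK_pm k) m

/-- the cube `|zᵢ| ≤ N` is invariant. -/
theorem abs_zT_act_le (k : Fin 16) {m : ℤ × ℤ × ℤ} {N : ℤ} (h : ∀ i, |zT m i| ≤ N) : ∀ i, |zT (actZ (RZ k) m) i| ≤ N :=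
  abs_zT_actZ_le (pK_inj k) (sK_pm k) h

/-- integer squared lengths are invariant. -/
theorem sumSq_zT_act (k : Fin 16) (x : ℤ × ℤ × ℤ) : ∑ i, zT (actZ (RZ k) x) i ^ 2 = ∑ i, zT x i ^ 2 :=
  sumSq_zT_actZ' (pK_inj k) (sK_pm k) x

/-- integer squared distances are invariant. -/
theorem sumSq_zT_act_sub (k : Fin 16) (x y : ℤ × ℤ × ℤ) :
    ∑ i, (zT (actZ (RZ k) x) i - zT (actZ (RZ k) y) i) ^ 2 = ∑ i, (zT x i - zT y i) ^ 2 :=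
  sumSq_zT_actZ (pK_inj k) (sK_pm k) x y

/-- an integer quadratic form with `(RZ k)ᵀ A (RZ k) = A` (decided once per cell, sixteen `3 × 3` products) is invariant — so every label
set cut out by parity, a cube and template-scalar windows is closed under the group. -/
theorem qZ_act (k : Fin 16) {A : Matrix (Fin 3) (Fin 3) ℤ} (hA : (RZ k).transpose * A * RZ k = A) (m : ℤ × ℤ × ℤ) :
    qZ A (actZ (RZ k) m) = qZ A m :=
  qZ_actZ A (RZ k) hA m

/-! ## §4 Canonical orbit representatives -/

/-- the canonical representative of the orbit of `m`: `(|m₀|, max |m₁| |m₂|, min |m₁| |m₂|)`. -/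
def rep16 (m : ℤ × ℤ × ℤ) : ℤ × ℤ × ℤ := (|m.1|, max |m.2.1| |m.2.2|, min |m.2.1| |m.2.2|)

/-- an element carrying `rep16 m` to `m`, found by search over the sixteen (element `0` if none — never the case: each cell decides
`∀ m ∈ list, actZ (RZ (symOf16 m)) (rep16 m) = m` over its near list, as TOY ROW 8's `hcov0`; e.g. `symOf16 (-3, 1, -2)` carries
`rep16 (-3, 1, -2) = (3, 2, 1)` back to `(-3, 1, -2)`). -/
def symOf16 (m : ℤ × ℤ × ℤ) : Fin 16 := ((List.finRange 16).find? fun k => actZ (RZ k) (rep16 m) = m).getD 0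


/-! ## §5 Orbit representatives are reached STRUCTURALLY (appended, hand-2 g47): the action in coordinates, `rep16` constant on orbits,
and `symOf16` correct for EVERY label — so a uniaxial cell's `hcov` needs no search and no per-label decision -/

section Reps
open Summit.AtomisticToContinuum.Crystallization.Theorems.FrustratedLawDichotomyCellSymmZ3 (ofVec)

/-- the action of element `k` on a triple, coordinatewise: signs `sK k`, and the swap `1 ↔ 2` for `k ≥ 8`. -/
theorem act_apply (k : Fin 16) (a b c : ℤ) :
    actZ (RZ k) (a, b, c) =
      if k.val < 8 then (sK k 0 * a, sK k 1 * b, sK k 2 * c) else (sK k 0 * a, sK k 2 * c, sK k 1 * b) := by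
  fin_cases k <;>
    simp [actZ, ofVec, RZ, spMatZ, pK, sK, zT, Matrix.mulVec, dotProduct, Fin.sum_univ_three]

/-- ★ every label is in the `Stab16`-orbit of its canonical representative: some element carries `rep16 m` to `m` (so the per-label `hcov`
fact of (272) `nn_of_reps` needs NO search or decision in a uniaxial cell). -/
theorem exists_act_rep16 (m : ℤ × ℤ × ℤ) : ∃ k : Fin 16, actZ (RZ k) (rep16 m) = m := by
  obtain ⟨a, b, c⟩ := m
  simp only [rep16]
  rcases le_total 0 a with ha | ha <;> rcases le_total 0 b with hb | hb <;> rcases le_total 0 c with hc | hc <;>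
    rcases le_total |c| |b| with hbc | hbc
  · refine ⟨0, ?_⟩
    rw [max_eq_left hbc, min_eq_right hbc]
    rw [act_apply, abs_of_nonneg ha, abs_of_nonneg hb, abs_of_nonneg hc]
    simp [sK]
  · refine ⟨8, ?_⟩
    rw [max_eq_right hbc, min_eq_left hbc]
    rw [act_apply, abs_of_nonneg ha, abs_of_nonneg hb, abs_of_nonneg hc]
    simp [sK]
  · refine ⟨4, ?_⟩
    rw [max_eq_left hbc, min_eq_right hbc]
    rw [act_apply, abs_of_nonneg ha, abs_of_nonneg hb, abs_of_nonpos hc]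
    simp [sK]
  · refine ⟨10, ?_⟩
    rw [max_eq_right hbc, min_eq_left hbc]
    rw [act_apply, abs_of_nonneg ha, abs_of_nonneg hb, abs_of_nonpos hc]
    simp [sK]
  · refine ⟨2, ?_⟩
    rw [max_eq_left hbc, min_eq_right hbc]
    rw [act_apply, abs_of_nonneg ha, abs_of_nonpos hb, abs_of_nonneg hc]
    simp [sK]
  · refine ⟨12, ?_⟩
    rw [max_eq_right hbc, min_eq_left hbc]
    rw [act_apply, abs_of_nonneg ha, abs_of_nonpos hb, abs_of_nonneg hc]
    simp [sK]
  · refine ⟨6, ?_⟩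
    rw [max_eq_left hbc, min_eq_right hbc]
    rw [act_apply, abs_of_nonneg ha, abs_of_nonpos hb, abs_of_nonpos hc]
    simp [sK]
  · refine ⟨14, ?_⟩
    rw [max_eq_right hbc, min_eq_left hbc]
    rw [act_apply, abs_of_nonneg ha, abs_of_nonpos hb, abs_of_nonpos hc]
    simp [sK]
  · refine ⟨1, ?_⟩
    rw [max_eq_left hbc, min_eq_right hbc]
    rw [act_apply, abs_of_nonpos ha, abs_of_nonneg hb, abs_of_nonneg hc]
    simp [sK]
  · refine ⟨9, ?_⟩
    rw [max_eq_right hbc, min_eq_left hbc]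
    rw [act_apply, abs_of_nonpos ha, abs_of_nonneg hb, abs_of_nonneg hc]
    simp [sK]
  · refine ⟨5, ?_⟩
    rw [max_eq_left hbc, min_eq_right hbc]
    rw [act_apply, abs_of_nonpos ha, abs_of_nonneg hb, abs_of_nonpos hc]
    simp [sK]
  · refine ⟨11, ?_⟩
    rw [max_eq_right hbc, min_eq_left hbc]
    rw [act_apply, abs_of_nonpos ha, abs_of_nonneg hb, abs_of_nonpos hc]
    simp [sK]
  · refine ⟨3, ?_⟩
    rw [max_eq_left hbc, min_eq_right hbc]
    rw [act_apply, abs_of_nonpos ha, abs_of_nonpos hb, abs_of_nonneg hc]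
    simp [sK]
  · refine ⟨13, ?_⟩
    rw [max_eq_right hbc, min_eq_left hbc]
    rw [act_apply, abs_of_nonpos ha, abs_of_nonpos hb, abs_of_nonneg hc]
    simp [sK]
  · refine ⟨7, ?_⟩
    rw [max_eq_left hbc, min_eq_right hbc]
    rw [act_apply, abs_of_nonpos ha, abs_of_nonpos hb, abs_of_nonpos hc]
    simp [sK]
  · refine ⟨15, ?_⟩
    rw [max_eq_right hbc, min_eq_left hbc]
    rw [act_apply, abs_of_nonpos ha, abs_of_nonpos hb, abs_of_nonpos hc]
    simp [sK]

/-- `rep16` is constant on orbits. -/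
theorem rep16_act (k : Fin 16) (m : ℤ × ℤ × ℤ) : rep16 (actZ (RZ k) m) = rep16 m := by
  obtain ⟨a, b, c⟩ := m
  fin_cases k <;> simp [act_apply, rep16, sK, abs_neg, max_comm, min_comm]

/-- ★ the searched element does carry `rep16 m` to `m` (from `exists_act_rep16`; no per-label decision needed). -/
theorem symOf16_spec (m : ℤ × ℤ × ℤ) : actZ (RZ (symOf16 m)) (rep16 m) = m := by
  obtain ⟨k, hk⟩ := exists_act_rep16 m
  unfold symOf16
  cases h : (List.finRange 16).find? (fun k => decide (actZ (RZ k) (rep16 m) = m)) with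
  | some k' =>
    have hk' := List.find?_some h
    simp only [decide_eq_true_eq] at hk'
    simpa using hk'
  | none =>
    exfalso
    have hn := (List.find?_eq_none.mp h) k (List.mem_finRange k)
    simp [hk] at hn

/-- the `hcov` hypothesis of (272) `nn_of_reps` for ANY label list of a uniaxial cell whose representatives are collected in `Reps`. -/
theorem hcov_of_reps {MN Reps : Finset (ℤ × ℤ × ℤ)} (hR : ∀ m ∈ MN, rep16 m ∈ Reps) :
    ∀ m ∈ MN, rep16 m ∈ Reps ∧ actZ (RZ (symOf16 m)) (rep16 m) = m :=
  fun m hm => ⟨hR m hm, symOf16_spec m⟩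

end Reps

end Summit.AtomisticToContinuum.Crystallization.Theorems.FrustratedLawDichotomyCellStab16
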